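import Literature.AnabelianGeometry.AbsoluteAnabelian.AbsTopIII.KummerTowerLawsAPI
import Literature.AnabelianGeometry.AbsoluteAnabelian.AbsTopIII.Thm19KummerContainerPushProofs
import HarnessLib

/-!
# [AbsTopIII] Thm. 1.9 (d): naturality of the Kummer maps along the TRANSITIONS of a system of
# NF-complements, from the per-curve laws (bridge core, proof-only)

Mochizuki, *Topics in Absolute Anabelian Geometry III*, §1, Theorem 1.9 (d), manuscript pp. 37–38 (lit key
`paper:url-5493eb38cbb7`): "`lim_{→V} H¹(Π_V, μ_Ẑ(Π_U))` — where `V` ranges over the open subschemes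
obtained by removing finite collections of NF-points from `Z ×_{k_Z} k′`"; Prop. 1.6 p. 34 "the associated
Kummer map" (functorial in the curve).

Cell abc-iut, sub-DAG `plan/L4/SUBDAG-AbsTopIII-Thm19.md` rows Thm19.d, bridge `NFTower.ofCurveLaws`
(abc-iut-L4-lead RULING #4a).  abc-iut-L4-t1's successor structures carry the per-curve laws:
`NaturalKummerModel.kummer_natural` (naturality along cofinite OPENS, API `kummerAddHom_unitRes`) and
`TowerKummerModel.kummer_bc` (naturality along BASE-CHANGE legs with change of coefficients).  A transition
`V_j → V_i` (`i ≤ j`) of a directed system of NF-complements factors as the open immersion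
`V_j ⊆ W := V_i ×_{k′_i} k′_j` followed by the base-change leg `W → V_i` over `Z ×_{k_Z} k′_j → Z ×_{k_Z} k′_i`;
the tower's NATURALITY square (abc-iut-w5-d213's `NFTower.naturality`, all classes pushed to the
coefficients `M_Z`) is the composite of the two laws, transported by the functoriality of pull-backs
(`cyclotomeModH1Pull_comp`, abc-iut-w5-d099) and of coefficient changes and their commutation
(`cyclotomeModH1Push_comp`, `cyclotomeModH1Pull_push_comm`, abc-iut-w5-d213).  THIS FILE proves that
composite in the generality of one tagged transition (`kummer_naturality_of_factorization`), the coherence of the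
base-field tower along such a transition (units and embeddings into `k̄`); the unit pull-backs are
abc-iut-L4-t1's `unitRes` (open legs) and `bcUnitRes` (base-change legs).  No definition, no named fact; nothing here bears on [IUTchIII] Cor. 3.12.
-/

noncomputable section

open CategoryTheory

namespace Literature.AnabelianGeometry.AbsoluteAnabelian.AbsTopIII

universe u

namespace TowerKummerModel

variable (N : TowerKummerModel.{u})

/-- **NATURALITY OF THE KUMMER MAPS ALONG A FACTORED TRANSITION** (the tower's naturality square from the
per-curve laws): for cofinite opens `V_j ⊆ W ⊆ Z_j`, `V_i ⊆ Z_i` with `Z_i`, `Z_j` proper, base-change legs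
`W → V_i` over `Z_j → Z_i`, legs `b_i : Π_{Z_i} → Π_Z` and `b_j := (Z_j → Z_i) ≫ b_i`, transition
`t := (V_j ⊆ W) ≫ (W → V_i)`, and a regular unit `f` of `V_i`: pulling `κ_{V_i}(f)` (pushed to `M_Z`) back
along `t` gives `κ_{V_j}(f|_{V_j})` (pushed to `M_Z`), where `f|_{V_j}` is `f` pulled back to `W` and
restricted to `V_j`.  Inputs: `kummerAddHom_unitRes` (open leg), `kummer_bc` (base-change leg), and the
functoriality / commutation of pull-backs and coefficient changes. [cite: MochizukiAbsTopIII2015, Thm 1.9 (d) p.37] -/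
theorem kummer_naturality_of_factorization {Vj W Zj Vi Zi Z : N.Curve}
    (hVW : N.IsCofiniteOpen Vj W) (hWZ : N.IsCofiniteOpen W Zj) (hj : N.IsCofiniteOpen Vj Zj)
    (hWV : N.IsBaseChangeOf W Vi) (hZZ : N.IsBaseChangeOf Zj Zi) (hi : N.IsCofiniteOpen Vi Zi)
    (hpi : N.IsProper Zi) (hpj : N.IsProper Zj) (bi : N.ext Zi ⟶ N.ext Z)
    {bj : N.ext Zj ⟶ N.ext Z} (hbj : bj = N.bc hZZ ≫ bi)
    {t : N.ext Vj ⟶ N.ext Vi} (ht : t = N.res hVW ≫ N.bc hWV)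
    (htcomm : t ≫ (N.res hi ≫ bi) = N.res hj ≫ bj) (f : N.regularUnits Vi) :
    (cyclotomeModH1Pull ZHatCoeff.{u} t (N.res hi ≫ bi) (N.res hj ≫ bj) htcomm).hom
        ((cyclotomeModH1Push ZHatCoeff.{u} (N.res hi) bi).hom
          (N.kummerAddHom hi hpi (Additive.ofMul f))) =
      (cyclotomeModH1Push ZHatCoeff.{u} (N.res hj) bj).hom
        (N.kummerAddHom hj hpj (N.unitRes hVW (N.bcUnitRes hWV (Additive.ofMul f)))) := by
  subst hbj
  subst ht
  -- the auxiliary commuting relations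
  have rc : N.res hVW ≫ N.res hWZ = N.res hj := N.res_comp hVW hWZ hj
  have rc' : N.res hVW ≫ (N.res hWZ ≫ N.bc hZZ) = N.res hj ≫ N.bc hZZ := by
    rw [← Category.assoc, rc]
  have sq : N.bc hWV ≫ N.res hi = N.res hWZ ≫ N.bc hZZ := N.bc_res_comm hWV hZZ hi hWZ
  have sq' : (N.res hVW ≫ N.bc hWV) ≫ N.res hi = N.res hj ≫ N.bc hZZ := by
    rw [Category.assoc, sq, ← Category.assoc, rc]
  have htc' : (N.res hVW ≫ N.bc hWV) ≫ (N.res hi ≫ bi) = (N.res hj ≫ N.bc hZZ) ≫ bi := by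
    rw [← Category.assoc, sq', Category.assoc]
  -- the classes and the maps involved
  let κW := N.kummerAddHom hWZ hpj (N.bcUnitRes hWV (Additive.ofMul f))
  let κi := N.kummerAddHom hi hpi (Additive.ofMul f)
  let PullVW := cyclotomeModH1Pull ZHatCoeff.{u} (N.res hVW) (N.res hWZ) (N.res hj) rc
  -- step 1: naturality along the open `Vj ⊆ W ⊆ Zj`
  have e0 : N.kummerAddHom hj hpj (N.unitRes hVW (N.bcUnitRes hWV (Additive.ofMul f))) =
      PullVW.hom κW :=
    N.kummerAddHom_unitRes hVW hWZ hj hpj (Additive.toMul (N.bcUnitRes hWV (Additive.ofMul f)))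
  rw [e0]
  let PushZj := cyclotomeModH1Push ZHatCoeff.{u} (N.res hj) (N.bc hZZ)
  let PushBi' := cyclotomeModH1Push ZHatCoeff.{u} (N.res hj ≫ N.bc hZZ) bi
  let PushZW := cyclotomeModH1Push ZHatCoeff.{u} (N.res hWZ) (N.bc hZZ)
  let PullVW' := cyclotomeModH1Pull ZHatCoeff.{u} (N.res hVW) (N.res hWZ ≫ N.bc hZZ)
    (N.res hj ≫ N.bc hZZ) rc'
  let PullWV := cyclotomeModH1Pull ZHatCoeff.{u} (N.bc hWV) (N.res hi) (N.res hWZ ≫ N.bc hZZ) sq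
  let PullT' := cyclotomeModH1Pull ZHatCoeff.{u} (N.res hVW ≫ N.bc hWV) (N.res hi) (N.res hj ≫ N.bc hZZ) sq'
  let PushBi := cyclotomeModH1Push ZHatCoeff.{u} (N.res hi) bi
  let PullT'' := cyclotomeModH1Pull ZHatCoeff.{u} (N.res hVW ≫ N.bc hWV) (N.res hi ≫ bi)
    ((N.res hj ≫ N.bc hZZ) ≫ bi) htc'
  -- step 2: decompose the push along `bc hZZ ≫ bi`
  have e1 : (cyclotomeModH1Push ZHatCoeff.{u} (N.res hj) (N.bc hZZ ≫ bi)).hom (PullVW.hom κW) =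
      PushBi'.hom (PushZj.hom (PullVW.hom κW)) :=
    (congrArg (fun φ => φ.hom (PullVW.hom κW))
      (cyclotomeModH1Push_comp ZHatCoeff.{u} (N.res hj) (N.bc hZZ) bi)).symm
  -- step 3: commute the push along `bc hZZ` past the pull-back along `Vj ⊆ W`
  have e2 : PushBi'.hom (PushZj.hom (PullVW.hom κW)) = PushBi'.hom (PullVW'.hom (PushZW.hom κW)) :=
    congrArg (fun y => PushBi'.hom y)
      (congrArg (fun φ => φ.hom κW)
        (cyclotomeModH1Pull_push_comm ZHatCoeff.{u} (N.res hVW) (N.res hWZ) (N.res hj) rc (N.bc hZZ) rc'))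
  -- step 4: naturality along the base-change leg `W → Vi` over `Zj → Zi`
  have e3 : PushBi'.hom (PullVW'.hom (PushZW.hom κW)) = PushBi'.hom (PullVW'.hom (PullWV.hom κi)) := by
    have hbc := N.kummerAddHom_bcUnitRes hWV hZZ hi hWZ hpi hpj f
    exact congrArg (fun y => PushBi'.hom (PullVW'.hom y)) hbc
  -- step 5: the two pull-backs compose to the pull-back along `t`
  have e4 : PushBi'.hom (PullVW'.hom (PullWV.hom κi)) = PushBi'.hom (PullT'.hom κi) :=
    congrArg (fun y => PushBi'.hom y)
      (congrArg (fun φ => φ.hom κi)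
        (cyclotomeModH1Pull_comp ZHatCoeff.{u} (N.bc hWV) (N.res hVW) (N.res hi) (N.res hWZ ≫ N.bc hZZ)
          (N.res hj ≫ N.bc hZZ) sq rc' rfl sq')).symm
  -- step 6: commute the pull-back along `t` past the push along `bi`
  have e5 : PushBi'.hom (PullT'.hom κi) = PullT''.hom (PushBi.hom κi) :=
    congrArg (fun φ => φ.hom κi)
      (cyclotomeModH1Pull_push_comm ZHatCoeff.{u} (N.res hVW ≫ N.bc hWV) (N.res hi) (N.res hj ≫ N.bc hZZ)
        sq' bi htc')
  exact (e1.trans (e2.trans (e3.trans (e4.trans e5)))).symm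

/-! ### Constants along a factored transition: the base-field tower is coherent -/

/-- `baseRes` is transitive along `U ⊆ U′ ⊆ X` (DERIVED from `fieldRes_comp`, `fieldRes_algebraMap` and the
injectivity of `k_U → K_U`). [cite: MochizukiAbsTopIII2015, Thm 1.9 (d) p.37] -/
theorem baseRes_comp_apply {U U' X : N.Curve} (h₁ : N.IsCofiniteOpen U U') (h₂ : N.IsCofiniteOpen U' X)
    (h : N.IsCofiniteOpen U X) (c : N.base X) :
    N.baseRes h c = N.baseRes h₁ (N.baseRes h₂ c) := by
  apply (algebraMap (N.base U) (N.FunctionField U)).injective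
  rw [← N.fieldRes_algebraMap h c, N.fieldRes_comp h₁ h₂ h, N.fieldRes_algebraMap h₂ c,
    N.fieldRes_algebraMap h₁]

/-- The constant regular unit of `c ∈ k′_i`, pulled back along `W → V_i` and restricted to `V_j ⊆ W`, is
the constant regular unit of the image `c′ ∈ k′_j` of `c` (`bcField_algebraMap`, `fieldRes_algebraMap`).
[cite: MochizukiAbsTopIII2015, Thm 1.9 (d) p.37] -/
theorem unitRes_bcUnits_constUnit {Vj W Vi : N.Curve} (hVW : N.IsCofiniteOpen Vj W)
    (hWV : N.IsBaseChangeOf W Vi) (c : (N.base Vi)ˣ) :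
    N.unitRes hVW (N.bcUnitRes hWV (Additive.ofMul (N.constUnit c))) =
      Additive.ofMul (N.constUnit (Units.map (N.baseRes hVW).toRingHom.toMonoidHom
        (Units.map (N.bcBase hWV).toMonoidHom c))) := by
  apply Additive.toMul.injective
  apply Subtype.ext
  apply Units.ext
  change N.fieldRes hVW (N.bcField hWV (algebraMap (N.base Vi) (N.FunctionField Vi) (c : N.base Vi))) =
    algebraMap (N.base Vj) (N.FunctionField Vj) (N.baseRes hVW (N.bcBase hWV (c : N.base Vi)))
  rw [N.bcField_algebraMap, N.fieldRes_algebraMap]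

/-- **Coherence of the base-field tower along a factored transition**: with `τ_i := (k′_i = k_{V_i} ≅
k_{Z_i}) ↪ k̄` (`bcEmb` of the leg `Z_i → Z` after `baseRes`), the image `c′ ∈ k′_j` of `c ∈ k′_i` under
`k_{V_i} → k_W ≅ k_{V_j}` satisfies `τ_j(c′) = τ_i(c)` (`baseRes` transitivity, the square `bcBase_baseRes`,
and `bcEmb_comp_bcBase'`). [cite: MochizukiAbsTopIII2015, Thm 1.9 (d) p.37] -/
theorem bcEmb_baseRes_coherent {Vj W Zj Vi Zi Z : N.Curve} (hVW : N.IsCofiniteOpen Vj W)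
    (hWZ : N.IsCofiniteOpen W Zj) (hj : N.IsCofiniteOpen Vj Zj) (hWV : N.IsBaseChangeOf W Vi)
    (hZZ : N.IsBaseChangeOf Zj Zi) (hi : N.IsCofiniteOpen Vi Zi) (hZi : N.IsBaseChangeOf Zi Z)
    (hZj : N.IsBaseChangeOf Zj Z) (c : N.base Vi) :
    N.bcEmb hZj ((N.baseRes hj).symm (N.baseRes hVW (N.bcBase hWV c))) =
      N.bcEmb hZi ((N.baseRes hi).symm c) := by
  -- write `c = baseRes hi c₁`
  obtain ⟨c₁, rfl⟩ : ∃ c₁, N.baseRes hi c₁ = c := ⟨(N.baseRes hi).symm c, (N.baseRes hi).apply_symm_apply c⟩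
  rw [RingEquiv.symm_apply_apply, N.bcBase_baseRes hWV hZZ hi hWZ c₁]
  have h1 : (N.baseRes hj).symm (N.baseRes hVW (N.baseRes hWZ (N.bcBase hZZ c₁))) = N.bcBase hZZ c₁ := by
    rw [← N.baseRes_comp_apply hVW hWZ hj, RingEquiv.symm_apply_apply]
  rw [h1]
  exact congrArg (fun φ : N.base Zi →+* AlgebraicClosure (N.base Z) => φ c₁)
    (N.bcEmb_comp_bcBase' hZZ hZi hZj)

/-- **NF-constants of a level are detected in `k̄_NF`** (Def. 1.7 (ii) along `V_i ⊆ Z_i → Z`): for the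
NF-curve `Z`, `c ∈ k′_i` is an NF-constant of `V_i` iff `τ_i(c) ∈ k̄_NF` (`isNFConstant_baseRes`,
`isNFConstant_iff_mem_kbarNF`). [cite: MochizukiAbsTopIII2015, Def 1.7 p.35] -/
theorem isNFConstant_iff_bcEmb_mem {Vi Zi Z : N.Curve} (hi : N.IsCofiniteOpen Vi Zi)
    (hZi : N.IsBaseChangeOf Zi Z) (hZ : N.IsNFCurve Z) (hVi : N.IsNFCurve Vi) (c : N.base Vi) :
    N.IsNFConstant Vi c ↔ N.bcEmb hZi ((N.baseRes hi).symm c) ∈ N.kbarNF Z := by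
  obtain ⟨c₁, rfl⟩ : ∃ c₁, N.baseRes hi c₁ = c := ⟨(N.baseRes hi).symm c, (N.baseRes hi).apply_symm_apply c⟩
  rw [RingEquiv.symm_apply_apply, N.isNFConstant_baseRes hi hVi c₁]
  exact N.isNFConstant_iff_mem_kbarNF hZi hZ c₁

end TowerKummerModel

end Literature.AnabelianGeometry.AbsoluteAnabelian.AbsTopIII
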